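import Summits.HodgeConjecture.CorCM.IrreducibleOddWeightsCanonicalPivot
import HarnessLib

/-!
# Index parity, I: the canonical pivot factors through the SHADOW on any partition refining the trace classes;
# the defect is a function of the shadow; parity and oddness of the shadows of CM types

COR-CM (cell `pub-hodgecm2`, binder seat `b16` gen 68, count-neutral claim INDEX PARITY, file P1 — abstract `G`-set
level; theorems only, no definition, no named fact, no `sorry`).  NEW as stated, hence under `Summits/`.  HONEST FRAMING:
finite-dimensional linear algebra and finite combinatorics about the Kubota–Dodson rank of a pair of CM types
(`dim Hg(A₀ × A₁)` versus `dim Hg(A₀) + dim Hg(A₁)` for abelian varieties with complex multiplication); `HC_CM` is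
neither used nor asserted.

SETTING (gen 64 R1/R3, gen 65 C1).  A group `G` acts on finite slots `E_i` (`G = Aut(ℂ)`, `E_i = Hom(K_i, ℂ)`); types
`Φ_i ⊆ E_i`, type vectors `u_i = 2·𝟙_{Φ_i} − 1`, MATRIX-COEFFICIENT SPACES `MC_i = span{c_{i,x}} ≤ ℚ^G`,
`c_{i,x}(g) = u_i(g·x)`; R1: `dim Hg(A₀) + dim Hg(A₁) − dim Hg(A₀ × A₁) = dim(MC₀ ∩ MC₁)`; C1 (canonical pivot):
`MC₀ ∩ MC₁ = F₀^{PW₁} ∩ MC₁`, `F₀^{PW₁}` = the matrix coefficients of slot `0` summed over the orbits of the POINTWISE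
STABILISER `PW₁` of slot `1` (for `Aut(ℂ)`: the classes of embeddings of `K₀` agreeing on the TRACE `K₀ ∩ L₁`).  A PIVOT
is a map `r : E₀ → Y` to an auxiliary `G`-set (restriction of embeddings to a subfield `T₀ ⊆ K₀`, `Y = Hom(T₀, ℂ)`); its
FIBRE SUMS `s_y(g) = Σ_{r x = y} u₀(g·x)` span `F^r ≤ MC₀`; for an equivariant `r` they are the matrix coefficients of
the SHADOW `w = r_* u₀ : Y → ℤ`, `w(y) = Σ_{r x = y} u₀(x)`: `s_y(g) = w(g·y)` (gen 64 `fibreSum_apply_eq_shadow_smul`).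

* §1 **FINER PIVOTS**.  If the fibres of `r` refine the `PW₁`-orbits (`r x = r x' ⟹ x' ∈ PW₁·x`; for `Aut(ℂ)`: the
  subfield `T₀` CONTAINS the trace `K₀ ∩ L₁`), then every `PW₁`-orbit sum is a sum of fibre sums
  (`span_stabOrbitSum_le_span_fibreSum_of_fine`), so **`MC₀ ∩ MC₁ = F^r ∩ MC₁`**
  (`span_coeff_inf_eq_span_fibreSum_inf_span_coeff_of_fine`) and
  **`rank Φ₀ + rank Φ₁ = rank(Φ₀,Φ₁) + 1 + dim(F^r ∩ MC₁)`** (`typeRank_add_typeRank_eq_add_finrank_fibreSum_inf_of_fine`;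
  iff form `typeRank_sigmaType_add_card_eq_iff_fibreSum_inf_eq_bot_of_fine`).
* §2 **THE DEFECT IS A FUNCTION OF THE SHADOW**.  For an equivariant pivot `F^r = span{g ↦ w(g·y) : y}`
  (`span_fibreSum_eq_span_shadowCoeff`); two types — of the same slot or of DIFFERENT `G`-sets over the same `Y` — with
  the same shadow have the same `F`-space (`span_fibreSum_eq_of_shadow_eq`), hence the same defect against every partner
  (`typeRank_add_typeRank_eq_add_finrank_shadowCoeff_inf_of_fine`).
* §3 **PARITY AND ODDNESS OF SHADOWS**.  `w(y) = 2·#(Φ ∩ r⁻¹y) − #r⁻¹y` (`fibre_shadow_eq_two_mul_card_sub_card`);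
  `#(Φ ∩ r⁻¹y) + #(Φ ∩ r⁻¹(ρy)) = #r⁻¹y` (`card_fibre_inter_add_card_fibre_inter_rho`); so `w(ρy) = −w(y)` and
  `w(y) ≡ f (mod 2)`, `|w(y)| ≤ f` on fibres of size `f`: for ODD `f` no shadow entry vanishes, for EVEN `f` all are even.
* §4 (sequel `IrreducibleOddWeightsIndexParityShadows`) SURJECTIVITY: for `ρ` a free involution on `Y` and every
  `k : Y → ℕ` with `k(y) + k(ρy) = f` there is a CM type meeting every fibre `r⁻¹y` in exactly `k(y)` points — the
  shadows of the CM types of `X` are EXACTLY the odd weights `w ≡ f (mod 2)`, `|w| ≤ f`; and PADDING (a larger index of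
  the same parity realises every shadow of the smaller).  Here: the title's parity half (§3).

## References

* [Gordon1999HodgeAVSurvey] B. B. Gordon, *A survey of the Hodge conjecture for abelian varieties*, §3 Theorem (proof),
  7.5–7.7, 9.4.3 (Yanai: types over a subtype with multiplicities).
* [Shimura1998] G. Shimura, *Abelian Varieties with Complex Multiplication and Modular Functions*, §8.1, §8.3, §18.1.
* [Serre1977] J.-P. Serre, *Linear Representations of Finite Groups*, GTM 42, §3.3, §7 Ex. 7.2.
* [Dodson1987] B. Dodson, J. Algebra 111 (1987), §1.1 (rank, lift of a type).
-/

set_option autoImplicit false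

noncomputable section

open scoped BigOperators Classical

universe u v v' w

namespace Summit.HodgeConjecture.CorCM.IrrOdd

open Literature.NumberTheory.ComplexMultiplication

variable {G : Type w} [Group G]

/-! ### §1 Finer pivots: any partition refining the `PW₁`-orbits computes `MC₀ ∩ MC₁` -/

section Fine

variable {I : Type u} {E : I → Type v} [∀ i, MulAction G (E i)] [∀ i, Fintype (E i)] {Y : Type v'} [DecidableEq Y]

omit [∀ i, Fintype (E i)] [DecidableEq Y] in
/-- If the fibres of `r : E_{i₀} → Y` refine the orbits of the pointwise stabiliser `PW₁` of slot `i₁`, each `PW₁`-orbit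
is a union of fibres. [cite: Serre1977, §7 Ex. 7.2] -/
theorem mem_stabOrbit_of_apply_eq {i₀ i₁ : I} (r : E i₀ → Y)
    (hfine : ∀ x x' : E i₀, r x = r x' → ∃ n : G, (∀ y : E i₁, n • y = y) ∧ n • x = x')
    {x₀ x x' : E i₀} (hx : ∃ n : G, (∀ y : E i₁, n • y = y) ∧ n • x₀ = x) (hxx' : r x' = r x) :
    ∃ n : G, (∀ y : E i₁, n • y = y) ∧ n • x₀ = x' := by
  obtain ⟨n, hn, rfl⟩ := hx
  obtain ⟨n', hn', rfl⟩ := hfine _ _ hxx'.symm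
  exact ⟨n' * n, fun y => by rw [mul_smul, hn y, hn' y], by rw [mul_smul]⟩

/-- **`F₀^{PW₁} ≤ F^r` for every pivot whose fibres refine the `PW₁`-orbits**: an orbit sum of matrix coefficients is the
sum of the fibre sums of the fibres it contains. [cite: Gordon1999HodgeAVSurvey, §3 Theorem (proof)]
[cite: Serre1977, §7 Ex. 7.2] -/
theorem span_stabOrbitSum_le_span_fibreSum_of_fine (Φ : ∀ i, Set (E i)) {i₀ i₁ : I} (r : E i₀ → Y)
    (hfine : ∀ x x' : E i₀, r x = r x' → ∃ n : G, (∀ y : E i₁, n • y = y) ∧ n • x = x') :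
    Submodule.span ℚ (Set.range fun x₀ : E i₀ => fun g : G =>
        ∑ x ∈ Finset.univ.filter (fun x : E i₀ => ∃ n : G, (∀ y : E i₁, n • y = y) ∧ n • x₀ = x),
          antiVec (Φ i₀) g x) ≤
      Submodule.span ℚ (Set.range fun y : Y => fun g : G =>
        ∑ x ∈ Finset.univ.filter (fun x => r x = y), antiVec (Φ i₀) g x) := by
  rw [Submodule.span_le]
  rintro _ ⟨x₀, rfl⟩
  set O := Finset.univ.filter (fun x : E i₀ => ∃ n : G, (∀ y : E i₁, n • y = y) ∧ n • x₀ = x) with hO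
  -- the fibre through a point of the orbit lies in the orbit
  have hfib : ∀ x ∈ O, Finset.univ.filter (fun x' : E i₀ => r x' = r x) = O.filter (fun x' => r x' = r x) := by
    intro x hx
    rw [hO, Finset.filter_filter]
    refine Finset.filter_congr fun x' _ => ⟨fun h => ⟨?_, h⟩, fun h => h.2⟩
    exact mem_stabOrbit_of_apply_eq r hfine (Finset.mem_filter.1 hx).2 h
  have hdec : (fun g : G => ∑ x ∈ O, antiVec (Φ i₀) g x) =
      ∑ y ∈ O.image r, (fun g : G => ∑ x ∈ Finset.univ.filter (fun x => r x = y), antiVec (Φ i₀) g x) := by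
    funext g
    rw [Finset.sum_apply]
    symm
    exact Finset.sum_image' (fun x : E i₀ => antiVec (Φ i₀) g x) fun x hx => by rw [hfib x hx]
  rw [SetLike.mem_coe]
  change (fun g : G => ∑ x ∈ O, antiVec (Φ i₀) g x) ∈ _
  rw [hdec]
  exact Submodule.sum_mem _ fun y _ => Submodule.subset_span ⟨y, rfl⟩

/-- **`MC₀ ∩ MC₁ = F^r ∩ MC₁` FOR EVERY PIVOT REFINING THE TRACE CLASSES** (the canonical pivot C1 is the coarsest
one; any finer equivariant partition of slot `0` — e.g. restriction to a subfield containing the trace — computes the same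
intersection). [cite: Gordon1999HodgeAVSurvey, §3 Theorem (proof)] [cite: Serre1977, §3.3 and §7 Ex. 7.2] -/
theorem span_coeff_inf_eq_span_fibreSum_inf_span_coeff_of_fine (Φ : ∀ i, Set (E i)) {i₀ i₁ : I} (r : E i₀ → Y)
    (hfine : ∀ x x' : E i₀, r x = r x' → ∃ n : G, (∀ y : E i₁, n • y = y) ∧ n • x = x') :
    Submodule.span ℚ (Set.range fun x : E i₀ => fun g : G => antiVec (Φ i₀) g x) ⊓
        Submodule.span ℚ (Set.range fun x : E i₁ => fun g : G => antiVec (Φ i₁) g x) =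
      Submodule.span ℚ (Set.range fun y : Y => fun g : G =>
          ∑ x ∈ Finset.univ.filter (fun x => r x = y), antiVec (Φ i₀) g x) ⊓
        Submodule.span ℚ (Set.range fun x : E i₁ => fun g : G => antiVec (Φ i₁) g x) := by
  refine le_antisymm ?_ (inf_le_inf_right _ (span_fibreSum_le_span_coeff (G := G) (Φ i₀) r))
  rw [span_coeff_inf_eq_span_stabOrbitSum_inf_span_coeff Φ i₀ i₁]
  exact inf_le_inf_right _ (span_stabOrbitSum_le_span_fibreSum_of_fine Φ r hfine)

variable [Fintype I] [∀ i, Nonempty (E i)]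

/-- **THE EXACT DEFECT ON A FINER PIVOT: `rank Φ₀ + rank Φ₁ = rank(Φ₀, Φ₁) + 1 + dim(F^r ∩ MC₁)`**, i.e.
`dim Hg(A₀) + dim Hg(A₁) − dim Hg(A₀ × A₁) = dim(F^r ∩ MC₁)` for every pivot of slot `0` refining the trace classes.
[cite: Gordon1999HodgeAVSurvey, §3 Theorem and 7.5–7.7] -/
theorem typeRank_add_typeRank_eq_add_finrank_fibreSum_inf_of_fine {ρ : G} {Φ : ∀ i, Set (E i)}
    (h : ∀ i, IsCMTypeWith ρ (Φ i)) {i₀ i₁ : I} (hI : ∀ j, j = i₀ ∨ j = i₁) (h01 : i₀ ≠ i₁) (r : E i₀ → Y)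
    (hfine : ∀ x x' : E i₀, r x = r x' → ∃ n : G, (∀ y : E i₁, n • y = y) ∧ n • x = x') :
    typeRank G (Φ i₀) + typeRank G (Φ i₁) = typeRank G (sigmaType Φ) + 1 +
      Module.finrank ℚ (Submodule.span ℚ (Set.range fun y : Y => fun g : G =>
            ∑ x ∈ Finset.univ.filter (fun x => r x = y), antiVec (Φ i₀) g x) ⊓
          Submodule.span ℚ (Set.range fun x : E i₁ => fun g : G => antiVec (Φ i₁) g x) : Submodule ℚ (G → ℚ)) := by
  rw [typeRank_add_typeRank_eq_of_pair h hI h01, span_coeff_inf_eq_span_fibreSum_inf_span_coeff_of_fine Φ r hfine]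

/-- **Additive iff `F^r ∩ MC₁ = 0`**, for every pivot refining the trace classes.
[cite: Gordon1999HodgeAVSurvey, §3 Theorem and 7.5–7.7] -/
theorem typeRank_sigmaType_add_card_eq_iff_fibreSum_inf_eq_bot_of_fine {ρ : G} {Φ : ∀ i, Set (E i)}
    (h : ∀ i, IsCMTypeWith ρ (Φ i)) {i₀ i₁ : I} (hI : ∀ j, j = i₀ ∨ j = i₁) (h01 : i₀ ≠ i₁) (r : E i₀ → Y)
    (hfine : ∀ x x' : E i₀, r x = r x' → ∃ n : G, (∀ y : E i₁, n • y = y) ∧ n • x = x') :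
    typeRank G (sigmaType Φ) + Fintype.card I = (∑ i, typeRank G (Φ i)) + 1 ↔
      Submodule.span ℚ (Set.range fun y : Y => fun g : G =>
            ∑ x ∈ Finset.univ.filter (fun x => r x = y), antiVec (Φ i₀) g x) ⊓
          Submodule.span ℚ (Set.range fun x : E i₁ => fun g : G => antiVec (Φ i₁) g x) =
        (⊥ : Submodule ℚ (G → ℚ)) := by
  rw [typeRank_sigmaType_add_card_eq_iff_inf_eq_bot_of_pair h hI h01,
    span_coeff_inf_eq_span_fibreSum_inf_span_coeff_of_fine Φ r hfine]

end Fine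

/-! ### §2 The defect is a function of the shadow -/

section Shadow

variable {X : Type v} [MulAction G X] [Fintype X] {Y : Type v'} [DecidableEq Y] [MulAction G Y]

/-- **`F^r = span{g ↦ w(g·y)}`**: for an equivariant pivot the fibre-sum space is spanned by the matrix coefficients of
the SHADOW `w(y) = Σ_{r x = y} u₀(x)`. [cite: Shimura1998, §8.1] [cite: Gordon1999HodgeAVSurvey, 9.4.3] -/
theorem span_fibreSum_eq_span_shadowCoeff (Φ : Set X) (r : X → Y) (hr : ∀ (g : G) (x : X), r (g • x) = g • r x) :
    Submodule.span ℚ (Set.range fun y : Y => fun g : G =>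
        ∑ x ∈ Finset.univ.filter (fun x => r x = y), antiVec Φ g x) =
      Submodule.span ℚ (Set.range fun y : Y => fun g : G =>
        ∑ x ∈ Finset.univ.filter (fun x => r x = g • y), antiVec Φ (1 : G) x) := by
  have hfun : (fun y : Y => fun g : G => ∑ x ∈ Finset.univ.filter (fun x => r x = y), antiVec Φ g x) =
      fun y : Y => fun g : G => ∑ x ∈ Finset.univ.filter (fun x => r x = g • y), antiVec Φ (1 : G) x :=
    funext fun y => funext fun g => fibreSum_apply_eq_shadow_smul Φ r hr y g
  rw [hfun]

/-- **SAME SHADOW ⟹ SAME `F`-SPACE**, for types `Φ ⊆ X`, `Φ′ ⊆ X′` of two (possibly different) `G`-sets over the same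
pivot set `Y` (two CM fields containing the same `T₀`). [cite: Gordon1999HodgeAVSurvey, 9.4.3] [cite: Shimura1998, §8.1] -/
theorem span_fibreSum_eq_of_shadow_eq {X' : Type u} [MulAction G X'] [Fintype X'] (Φ : Set X) (Φ' : Set X')
    (r : X → Y) (r' : X' → Y) (hr : ∀ (g : G) (x : X), r (g • x) = g • r x)
    (hr' : ∀ (g : G) (x : X'), r' (g • x) = g • r' x)
    (hw : ∀ y : Y, ∑ x ∈ Finset.univ.filter (fun x => r x = y), antiVec Φ (1 : G) x =
      ∑ x ∈ Finset.univ.filter (fun x => r' x = y), antiVec Φ' (1 : G) x) :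
    Submodule.span ℚ (Set.range fun y : Y => fun g : G =>
        ∑ x ∈ Finset.univ.filter (fun x => r x = y), antiVec Φ g x) =
      Submodule.span ℚ (Set.range fun y : Y => fun g : G =>
        ∑ x ∈ Finset.univ.filter (fun x => r' x = y), antiVec Φ' g x) := by
  rw [span_fibreSum_eq_span_shadowCoeff Φ r hr, span_fibreSum_eq_span_shadowCoeff Φ' r' hr']
  simp only [hw]

variable {I : Type u} {E : I → Type v} [∀ i, MulAction G (E i)] [∀ i, Fintype (E i)] [Fintype I] [∀ i, Nonempty (E i)]

/-- **THE DEFECT AS A FUNCTION OF THE SHADOW: `rank Φ₀ + rank Φ₁ = rank(Φ₀,Φ₁) + 1 + dim(span{g ↦ w₀(g·y)} ∩ MC₁)`**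
for every equivariant pivot of slot `0` refining the trace classes — `dim Hg(A₀) + dim Hg(A₁) − dim Hg(A₀ × A₁)` depends
on `Φ₀` only through `w₀ = r_* u₀`. [cite: Gordon1999HodgeAVSurvey, §3 Theorem, 7.5–7.7 and 9.4.3] -/
theorem typeRank_add_typeRank_eq_add_finrank_shadowCoeff_inf_of_fine {ρ : G} {Φ : ∀ i, Set (E i)}
    (h : ∀ i, IsCMTypeWith ρ (Φ i)) {i₀ i₁ : I} (hI : ∀ j, j = i₀ ∨ j = i₁) (h01 : i₀ ≠ i₁) (r : E i₀ → Y)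
    (hr : ∀ (g : G) (x : E i₀), r (g • x) = g • r x)
    (hfine : ∀ x x' : E i₀, r x = r x' → ∃ n : G, (∀ y : E i₁, n • y = y) ∧ n • x = x') :
    typeRank G (Φ i₀) + typeRank G (Φ i₁) = typeRank G (sigmaType Φ) + 1 +
      Module.finrank ℚ (Submodule.span ℚ (Set.range fun y : Y => fun g : G =>
            ∑ x ∈ Finset.univ.filter (fun x => r x = g • y), antiVec (Φ i₀) (1 : G) x) ⊓
          Submodule.span ℚ (Set.range fun x : E i₁ => fun g : G => antiVec (Φ i₁) g x) : Submodule ℚ (G → ℚ)) := by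
  rw [typeRank_add_typeRank_eq_add_finrank_fibreSum_inf_of_fine h hI h01 r hfine,
    span_fibreSum_eq_span_shadowCoeff (Φ i₀) r hr]

end Shadow

/-! ### §3 Parity and oddness of shadows -/

section Parity

variable {X : Type v} [MulAction G X] [Fintype X] {Y : Type v'} [DecidableEq Y]

/-- **`w(y) = 2·#(Φ ∩ r⁻¹y) − #r⁻¹y`**: the shadow counts the points of the type in the fibre.
[cite: Gordon1999HodgeAVSurvey, 9.4.3] -/
theorem fibre_shadow_eq_two_mul_card_sub_card (Φ : Set X) (r : X → Y) (y : Y) :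
    ∑ x ∈ Finset.univ.filter (fun x => r x = y), antiVec Φ (1 : G) x =
      2 * ((Finset.univ.filter (fun x => r x = y ∧ x ∈ Φ)).card : ℚ) -
        ((Finset.univ.filter (fun x => r x = y)).card : ℚ) := by
  have hval : ∀ x : X, antiVec Φ (1 : G) x = 2 * (if x ∈ Φ then (1 : ℚ) else 0) - 1 := fun x => by
    simp only [antiVec, translateInd, one_smul]
  simp only [hval, Finset.sum_sub_distrib, ← Finset.mul_sum, Finset.sum_boole, Finset.sum_const, nsmul_eq_mul,
    mul_one, Finset.filter_filter]

/-- **`#(Φ ∩ r⁻¹y) + #(Φ ∩ r⁻¹(ρy)) = #r⁻¹y`** for a CM type and a `ρ`-compatible pivot: `x ↦ ρx` maps the points of the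
fibre over `y` OUTSIDE `Φ` bijectively onto the points of the fibre over `ρy` INSIDE `Φ`. [cite: Shimura1998, §18.1]
[cite: Gordon1999HodgeAVSurvey, 9.4.3] -/
theorem card_fibre_inter_add_card_fibre_inter_rho [MulAction G Y] {ρ : G} {Φ : Set X} (h : IsCMTypeWith ρ Φ)
    (r : X → Y)
    (hr : ∀ x : X, r (ρ • x) = ρ • r x) (hρY : ∀ y : Y, ρ • ρ • y = y) (y : Y) :
    (Finset.univ.filter (fun x => r x = y ∧ x ∈ Φ)).card +
        (Finset.univ.filter (fun x => r x = ρ • y ∧ x ∈ Φ)).card =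
      (Finset.univ.filter (fun x => r x = y)).card := by
  have himage : (Finset.univ.filter (fun x => r x = y ∧ x ∉ Φ)).image (fun x => ρ • x) =
      Finset.univ.filter (fun x => r x = ρ • y ∧ x ∈ Φ) := by
    ext z
    simp only [Finset.mem_image, Finset.mem_filter, Finset.mem_univ, true_and]
    constructor
    · rintro ⟨x, ⟨hx, hxΦ⟩, rfl⟩
      exact ⟨by rw [hr, hx], (h.rho_smul_mem_iff x).2 hxΦ⟩
    · rintro ⟨hz, hzΦ⟩
      refine ⟨ρ • z, ⟨?_, (h.mem_iff z).1 hzΦ⟩, h.invol z⟩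
      rw [hr, hz, hρY]
  have hinj : Set.InjOn (fun x : X => ρ • x) ↑(Finset.univ.filter (fun x => r x = y ∧ x ∉ Φ)) :=
    fun x _ x' _ hxx' => by simpa only [h.invol] using congrArg (fun z => ρ • z) hxx'
  rw [← himage, Finset.card_image_of_injOn hinj]
  have hsplit := Finset.card_filter_add_card_filter_not
    (s := Finset.univ.filter (fun x : X => r x = y)) (fun x => x ∈ Φ)
  simp only [Finset.filter_filter] at hsplit
  exact hsplit

/-- **SHADOWS ARE ODD: `w(ρy) = −w(y)`.** [cite: Shimura1998, §18.1] [cite: Gordon1999HodgeAVSurvey, 9.4.3] -/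
theorem fibre_shadow_rho [MulAction G Y] {ρ : G} {Φ : Set X} (h : IsCMTypeWith ρ Φ) (r : X → Y)
    (hr : ∀ x : X, r (ρ • x) = ρ • r x) (hρY : ∀ y : Y, ρ • ρ • y = y) (y : Y) :
    ∑ x ∈ Finset.univ.filter (fun x => r x = ρ • y), antiVec Φ (1 : G) x =
      -∑ x ∈ Finset.univ.filter (fun x => r x = y), antiVec Φ (1 : G) x := by
  have hcard : (Finset.univ.filter (fun x => r x = ρ • y)).card = (Finset.univ.filter (fun x => r x = y)).card := by
    have h1 := card_fibre_inter_add_card_fibre_inter_rho h r hr hρY y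
    have h2 := card_fibre_inter_add_card_fibre_inter_rho h r hr hρY (ρ • y)
    rw [hρY] at h2
    omega
  have hk := card_fibre_inter_add_card_fibre_inter_rho h r hr hρY y
  rw [fibre_shadow_eq_two_mul_card_sub_card, fibre_shadow_eq_two_mul_card_sub_card, hcard]
  have hk' : ((Finset.univ.filter (fun x => r x = ρ • y ∧ x ∈ Φ)).card : ℚ) =
      (Finset.univ.filter (fun x => r x = y)).card - (Finset.univ.filter (fun x => r x = y ∧ x ∈ Φ)).card := by
    rw [eq_sub_iff_add_eq, ← Nat.cast_add, add_comm, hk]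
  rw [hk']
  ring

/-- **PARITY: `w(y) = 2k − f` with `k = #(Φ ∩ r⁻¹y) ≤ f = #r⁻¹y`** — on fibres of ODD size no shadow entry vanishes, on
fibres of EVEN size every entry is even. [cite: Gordon1999HodgeAVSurvey, 9.4.3] -/
theorem exists_fibre_shadow_eq_two_mul_sub (Φ : Set X) (r : X → Y) (y : Y) :
    ∃ k : ℕ, k ≤ (Finset.univ.filter (fun x => r x = y)).card ∧
      ∑ x ∈ Finset.univ.filter (fun x => r x = y), antiVec Φ (1 : G) x =
        2 * (k : ℚ) - ((Finset.univ.filter (fun x => r x = y)).card : ℚ) :=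
  ⟨(Finset.univ.filter (fun x => r x = y ∧ x ∈ Φ)).card,
    by
      rw [← Finset.filter_filter]
      exact Finset.card_filter_le _ _,
    fibre_shadow_eq_two_mul_card_sub_card Φ r y⟩

/-- On a fibre of ODD size the shadow does not vanish. [cite: Gordon1999HodgeAVSurvey, 9.4.3] -/
theorem fibre_shadow_ne_zero_of_odd (Φ : Set X) (r : X → Y) (y : Y)
    (hodd : Odd (Finset.univ.filter (fun x => r x = y)).card) :
    ∑ x ∈ Finset.univ.filter (fun x => r x = y), antiVec Φ (1 : G) x ≠ 0 := by
  obtain ⟨k, -, hk⟩ := exists_fibre_shadow_eq_two_mul_sub (G := G) Φ r y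
  rw [hk]
  intro h0
  obtain ⟨m, hm⟩ := hodd
  have h1 : (2 * k : ℚ) = (2 * m + 1 : ℕ) := by rw [← hm]; linarith
  have h2 : 2 * k = 2 * m + 1 := by exact_mod_cast h1
  omega

/-- On a fibre of EVEN size the shadow is an even integer `2(k − f/2)`. [cite: Gordon1999HodgeAVSurvey, 9.4.3] -/
theorem exists_fibre_shadow_eq_two_mul_of_even (Φ : Set X) (r : X → Y) (y : Y)
    (heven : Even (Finset.univ.filter (fun x => r x = y)).card) :
    ∃ z : ℤ, ∑ x ∈ Finset.univ.filter (fun x => r x = y), antiVec Φ (1 : G) x = 2 * (z : ℚ) := by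
  obtain ⟨k, -, hk⟩ := exists_fibre_shadow_eq_two_mul_sub (G := G) Φ r y
  obtain ⟨m, hm⟩ := heven
  refine ⟨(k : ℤ) - m, ?_⟩
  rw [hk, hm]
  push_cast
  ring

end Parity

end Summit.HodgeConjecture.CorCM.IrrOdd

end
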